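import Literature.MathematicalPhysics.QuantumFieldTheory.Balaban1983to89.B12NodeKnitRecord13SepCoPH

/-!
# BalabanUVNodes ∕ N09 at the STAGE-13 v1.7 `SepCoPH` record — the SUPPORT binder (F7a) and the cut-off invariance (M1) of the Theorem-3 member
# WEAKENED TO ALMOST-EVERYWHERE CURRENCY: dag-n09-a's on-domain engine and node00-def-K0e's §5 re-run with `ρ_j` lift-invariant `dU`-a.e. only

TRACK A (YM-PLAN §2b, node N09 of 28 = [B12] = [Balaban1987RG1] (CMP 109) Thm 3 p. 264), WIDTH SEAT `pub-ymgap-dag-n09-w3` (g0; HUMAN RULING D-0149, director-ym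
№197; plan g77 W-SEAT-START-LIST §n09 item 3 «support ∕ nesting bookkeeping on gauge-stable sets inside the maximal regular sets»), FILE 2.  Key of record it serves:
K1⁷ `StabilityBAtRecordR13SepCoPH` = stmt-QuantumFields-20542 (`--supports`, count-neutral helper).  A NEW importing module (imports dag-n24-c g8's junction
`B12NodeKnitRecord13SepCoPH` only); THEOREMS ONLY, def-free, sorry-free, standard axioms.

WHY.  In the located form of N09's Theorem-3 member at the v1.7 record (dag-n24-c `B12NodeKnitRecord13SepCoPH.thm3Member_stage13SepCoPH_of_regSets`, 17H's
`h09inv ∕ h09supp`) two binders are POINTWISE statements about the (2.9) cut-off `χ^{(2.9)}` at EVERY step-`(i+1)` field: (M1) `hχinv` «`χ_j(U^{v∘blockOf}) = χ_j(U)`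
for all `U`» and (F7a) `hχreg` «`χ_{i+1}(U) = 0` for all `U ∉ regSetOfRecord K i ρ_i`».  Both are consumed ONLY to make the (0.19) density `ρ_j = χ_j·e^{−GF/g_j²+A_j}`
lift-invariant as an input of the PUSH-FORWARD step ([I] p. 254: «if ρ is a gauge invariant function, then Tρ is gauge invariant also», tree:
`B12RTGaugeInvariance254.isRT_comp_gaugeAct` + `ae_eq_of_isRT`), and the push-forward identity `Setup.IsRT` reads `ρ_j` UNDER AN INTEGRAL — it depends on the
`dU`-a.e. class of `ρ_j` only.  So the engine runs verbatim when `ρ_j` is lift-invariant ALMOST EVERYWHERE, i.e. under (M1-ae) «`χ_j(U^{v∘blockOf}) = χ_j(U)` for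
`dU`-a.e. `U`, each coarse `v`» and (F7a-ae) «`dU`-a.e. `U`: `U ∉ regSetOfRecord K i ρ_i ⇒ χ_{i+1}(U) = 0`»: THIS FILE re-runs node00-def-K0e's `CanonicalTransportOfRecord`
§5 (`transportOfRecord_comp_gaugeAct_ae_eq`, `gaugeAct_mem_regSetOfRecord_iff`, `TcanOfRecord_gaugeAct_of_mem_regSet`) and dag-n09-a's MODULE 5 §1–§3
(`liftInvariant_integrand_of_invOn`, `invOn_effActionHT_of_stepsOn`, `hCompT_of_stepsOn`, `thm3Member_of_indATPlug_of_stepsOn`) with the a.e. antecedent, and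
re-knits dag-n24-c's §2–§3 at the record.  The POINTWISE members that remain are the ones print needs pointwise: the invariance of `A_j` ON the bookkeeping sets
(`D (i+1) ⊆ regSetOfRecord K i ρ_i`, open gauge-stable sets where K0e's canonical version is continuous — determinacy `Measure.eqOn_open_of_ae_eq`) and the
NESTING (F7b) of the averaged backgrounds `Ū^{i+1}(U_k V)` (regular points, `V ∈ domAltOfRecord θ.ν K k`).  Why the weakening is worth recording: the exceptional
sets of (M1) ∕ (F7a) at the bare-choice record — the documented junk corner of `critCfgOfRecord` off the solvable set (node00-def-K0e `critCfgOfRecord_of_not`;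
dag-n09-w2's item 2) and the fibre-boundary points of the fluctuation tubes where a fibre integral of an indicator may fail to be continuous (K0e's located
analysis debt (F2)) — need only be `dU`-NULL, not empty, for N09's member.

WHAT THIS FILE PROVES (13 theorems).  §1 push-forward, generic group: `isRT_comp_gaugeAct_of_ae` (p. 254's key step for an a.e.-lift-invariant `ρ`).  §2 K0e §5
in a.e. currency at the record: `transportOfRecord_comp_gaugeAct_ae_eq_of_ae`, `gaugeAct_mem_regSetOfRecord_iff_of_ae`, `TcanOfRecord_gaugeAct_of_mem_regSet_of_ae`,
`stepOn_TβOfRecord₁₃_of_subset_regSet_of_ae`.  §3 MODULE 5 in a.e. currency: `integrand_comp_liftAct_ae_eq_of_invOn`, `invOn_effActionHT_of_stepsOn_ae`,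
`hCompT_of_stepsOn_ae`, `thm3Member_of_indATPlug_of_stepsOn_ae`.  §4 at the ₁₃ record: `thm3Member_stage13SepCoPH_of_stepsOn_ae`,
`thm3Member_stage13SepCoPH_of_regSets_ae`, `thm3Member_forall_stage13SepCoPH_of_regSets_ae` (N24's `h09T` from (M1-ae), (F7a-ae), (I19), [B11] ×3, (F7b)),
`thm3Member_forall_stage13SepCoPH_of_regSets_of_measurableUk_ae` ((I19) ↦ (H-U) twin).  dag-n24-c's pointwise located form is the special case `Filter.Eventually.of_forall`.

HONEST FRAMING: count-neutral kernel bookkeeping BY NAME (Mathlib a.e. filters, `integral_congr_ae`; the tree's `isRT_transportOfRecord`, `ae_eq_of_isRT`,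
`preimage_regSet_eq`, `canonVersion_comp_eqOn`, `invOn_effActionHT_succ_of_stepOn`, `hCompT_of_hOrbit_of_invOn`, `thm3Member_of_indATPlug_of_hCompT`, def-T's faces);
NO estimate of Bałaban's is proved; (M1-ae), (F7a-ae), (F7b), (I19) and [B11] Thm 1's three binders are DISPLAYED hypotheses, located in print, none asserted; whether
the exceptional sets ARE null at the record is the same open analysis as before, in a weaker currency; N09 NOT discharged; conjunct 1 (Lemma 4) untouched; K0⁷ ∕ K1⁷
NOT closed; counts unmoved (typed 28∕28 · discharged 5∕27); one finite four-torus programme at fixed `ε = L^{−K}` per run — R4 closes the conditional rung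
`BalabanLadder.UV` only; NOT ℝ⁴, NOT infinite volume, NOT OS, NOT a mass gap, NOT Clay.
-/

noncomputable section

namespace Summit.QuantumFields.YangMills.BalabanUVNodes.N09AtRecord13SepCoPHSupportAE

open MeasureTheory Set
open Literature.MathematicalPhysics.QuantumFieldTheory.Balaban1983to89
open Literature.MathematicalPhysics.QuantumFieldTheory.Balaban1983to89.T4Continuum (T4Family)
open Literature.MathematicalPhysics.QuantumFieldTheory.Balaban1983to89.DagBinding (WorldP leavesP)
open Literature.MathematicalPhysics.QuantumFieldTheory.Balaban1983to89.Node00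
open Literature.MathematicalPhysics.QuantumFieldTheory.Balaban1983to89.FlowStep (HBeta prefixOf)
open Literature.MathematicalPhysics.QuantumFieldTheory.Balaban1983to89.FlowStepRuns (genSeq genFlow)
open Literature.MathematicalPhysics.QuantumFieldTheory.Balaban1983to89.T4FlagMemory (extd)
open Literature.MathematicalPhysics.QuantumFieldTheory.Balaban1983to89.B12Eq019ActionBody (integrand integrand_apply)
open Literature.MathematicalPhysics.QuantumFieldTheory.Balaban1983to89.B12RTGaugeInvariance254
  (LiftInvariant liftTransf invTransf isRT_comp_gaugeAct ae_eq_of_isRT integrable_comp_gaugeAct measurePreserving_gaugeAct measurable_gaugeAct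
    gaugeAct_inv_gaugeAct gaugeAct_gaugeAct_inv invTransf_liftTransf avg_gaugeAct_liftTransf)
open Literature.MathematicalPhysics.QuantumFieldTheory.Balaban1983to89.GaugeField (GaugeInvariant gaugeAct)
open Literature.MathematicalPhysics.QuantumFieldTheory.Balaban1983to89.B12EffectiveActionInvarianceT (gfOfRecord_liftInvariant)
open Literature.MathematicalPhysics.QuantumFieldTheory.Balaban1983to89.B12ContinuousTransportInvariance (continuous_gaugeAct)
open Literature.MathematicalPhysics.QuantumFieldTheory.Balaban1983to89.B12ContinuousTransportInvarianceOn (invOn_effActionHT_succ_of_stepOn hCompT_of_hOrbit_of_invOn)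
open Literature.MathematicalPhysics.QuantumFieldTheory.Balaban1983to89.B12NodeKnitIndAPlug (thm3Member_of_indATPlug_of_hCompT)
open Literature.MathematicalPhysics.QuantumFieldTheory.Balaban1983to89.B12NodeKnitRecord13SepCoPH
  (flow_stage13SepCoPH indAss_stage13SepCoPH_iff integrable_betaInput_stage13_of_measurableUk)
open Literature.MathematicalPhysics.QuantumFieldTheory.Balaban1983to89.T4AveragingDisintegration (integrable_kernelTransport)

/-! ## §1. The push-forward key step for an a.e.-lift-invariant density (generic gauge group) -/

section PushForward

variable {P : Params} {j : ℕ} {G : Type*} [GaugeGroup G] [MeasurableSpace G] [HaarData G] [MeasurableMul₂ G]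

/-- **p. 254's KEY STEP IN A.E. CURRENCY**: if `ρ′` is a renormalization image of `ρ` (`Setup.IsRT`) for a COVARIANT averaging and `ρ` is invariant under the
block-constant lift of every coarse gauge transformation `dU`-ALMOST EVERYWHERE, then `V ↦ ρ′(V^v)` is a renormalization image of `ρ` too — the tree's
`isRT_comp_gaugeAct` verbatim except that its last step (gauge invariance of `dU` and of `ρ`) is an `integral_congr_ae`: `IsRT` reads `ρ` under `∫ dU` only.
[cite: Balaban1987RG1, (0.13) p.254 and (2.1) p.265; Balaban1985Averaging, (10)–(11) p.19] -/
theorem isRT_comp_gaugeAct_of_ae (hj : j + 1 ≤ P.m + P.K) (av : Averaging P j G) {ρ : Density P j G}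
    {ρ' : Density P (j+1) G} (h : IsRT av.avg ρ ρ')
    (hρ : ∀ v : GaugeTransf P (j+1) G, ∀ᵐ U ∂(fieldMeasure P j G), ρ (gaugeAct (liftTransf v) U) = ρ U)
    (v : GaugeTransf P (j+1) G) :
    IsRT av.avg ρ (fun V => ρ' (gaugeAct v V)) := by
  intro f hf hbd
  obtain ⟨C, hC⟩ := hbd
  have hf' : Measurable (fun V : GaugeField P (j+1) G => f (gaugeAct (invTransf v) V)) := hf.comp (measurable_gaugeAct _)
  have hbd' : ∃ C : ℝ, ∀ V : GaugeField P (j+1) G, |f (gaugeAct (invTransf v) V)| ≤ C := ⟨C, fun V => hC _⟩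
  have key := h _ hf' hbd'
  calc ∫ V, ρ' (gaugeAct v V) * f V ∂(fieldMeasure P (j+1) G)
      = ∫ V, ρ' (gaugeAct v V) * f (gaugeAct (invTransf v) (gaugeAct v V)) ∂(fieldMeasure P (j+1) G) := by simp_rw [gaugeAct_inv_gaugeAct]
    _ = ∫ V, ρ' V * f (gaugeAct (invTransf v) V) ∂(fieldMeasure P (j+1) G) :=
        B12FaddeevPopov016.integral_comp_gaugeAct v (fun V => ρ' V * f (gaugeAct (invTransf v) V))
    _ = ∫ U, ρ U * f (gaugeAct (invTransf v) (av.avg U)) ∂(fieldMeasure P j G) := key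
    _ = ∫ U, ρ U * f (av.avg (gaugeAct (liftTransf (invTransf v)) U)) ∂(fieldMeasure P j G) := by
        simp_rw [avg_gaugeAct_liftTransf hj av (invTransf v)]
    _ = ∫ U, ρ (gaugeAct (liftTransf v) U) * f (av.avg (gaugeAct (liftTransf (invTransf v)) (gaugeAct (liftTransf v) U))) ∂(fieldMeasure P j G) :=
        (B12FaddeevPopov016.integral_comp_gaugeAct (liftTransf v) (fun U => ρ U * f (av.avg (gaugeAct (liftTransf (invTransf v)) U)))).symm
    _ = ∫ U, ρ U * f (av.avg U) ∂(fieldMeasure P j G) := by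
        refine integral_congr_ae ?_
        filter_upwards [hρ v] with U hU
        rw [hU, ← invTransf_liftTransf, gaugeAct_inv_gaugeAct]

end PushForward

/-! ## §2. node00-def-K0e's §5 in a.e. currency: the transform of an a.e.-lift-invariant density is a.e. gauge invariant, its maximal regular set is
gauge-stable, and the canonical-version transport is gauge invariant ON it -/

section Gauge

variable {F : T4Family} {N : ℕ} [NeZero N]

/-- **THE TRANSFORM OF AN A.E.-LIFT-INVARIANT DENSITY IS A.E. GAUGE-INVARIANT** ([I] p. 254 in the a.e. currency, a.e. antecedent): for `k < K`, `ρ` integrable with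
`ρ(U^{v∘blockOf}) = ρ(U)` for `dU`-a.e. `U` (each coarse `v`), `(Tρ)(V^v) = (Tρ)(V)` for a.e. `V` — K0e's `transportOfRecord_comp_gaugeAct_ae_eq` with §1.
[cite: Balaban1987RG1, (0.13) p.254; Balaban1985Averaging, (11)–(13) p.19] -/
theorem transportOfRecord_comp_gaugeAct_ae_eq_of_ae {K k : ℕ} (hk : k < K) {ρ : Density (F.P K) k (SU N)} (hρ : Integrable ρ (fieldMeasure (F.P K) k (SU N)))
    (hlift : ∀ v : GaugeTransf (F.P K) (k + 1) (SU N), ∀ᵐ U ∂(fieldMeasure (F.P K) k (SU N)), ρ (gaugeAct (liftTransf v) U) = ρ U)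
    (v : GaugeTransf (F.P K) (k + 1) (SU N)) :
    (fun V => transportOfRecord F N K k ρ (gaugeAct v V)) =ᵐ[fieldMeasure (F.P K) (k + 1) (SU N)] transportOfRecord F N K k ρ := by
  have hj : k + 1 ≤ (F.P K).m + (F.P K).K := by simp only [T4Continuum.T4Family.P_K]; omega
  have h := isRT_transportOfRecord F N K k hk ρ hρ
  have hi : Integrable (transportOfRecord F N K k ρ) (fieldMeasure (F.P K) (k + 1) (SU N)) :=
    integrable_kernelTransport (fieldMeasure (F.P K) k (SU N)) (fieldMeasure (F.P K) (k + 1) (SU N)) (avOfRecord_measurable F N K k)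
      (avOfRecord_haarAC F N K k hk) hρ
  exact ae_eq_of_isRT (isRT_comp_gaugeAct_of_ae hj (avOfRecord F N K k) h hlift v) h (integrable_comp_gaugeAct hi v) hi

/-- **THE MAXIMAL REGULAR SET OF RECORD IS GAUGE-STABLE, a.e. antecedent**: `V^v ∈ regSetOfRecord K k ρ ↔ V ∈ regSetOfRecord K k ρ` for `k < K`, `ρ` integrable and
a.e.-lift-invariant (K0e's `gaugeAct_mem_regSetOfRecord_iff`, proof verbatim over §2's a.e. transform identity). [cite: Balaban1987RG1, (0.13) p.254 and p.263] -/
theorem gaugeAct_mem_regSetOfRecord_iff_of_ae {K k : ℕ} (hk : k < K) {ρ : Density (F.P K) k (SU N)} (hρ : Integrable ρ (fieldMeasure (F.P K) k (SU N)))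
    (hlift : ∀ v : GaugeTransf (F.P K) (k + 1) (SU N), ∀ᵐ U ∂(fieldMeasure (F.P K) k (SU N)), ρ (gaugeAct (liftTransf v) U) = ρ U)
    (v : GaugeTransf (F.P K) (k + 1) (SU N)) (V : PBond (F.P K) (k + 1) → SU N) :
    gaugeAct v V ∈ regSetOfRecord F N K k ρ ↔ V ∈ regSetOfRecord F N K k ρ := by
  have hΦc : Continuous (X := PBond (F.P K) (k + 1) → SU N) (Y := PBond (F.P K) (k + 1) → SU N) (gaugeAct v) :=
    continuous_gaugeAct v
  have hΨc : Continuous (X := PBond (F.P K) (k + 1) → SU N) (Y := PBond (F.P K) (k + 1) → SU N) (gaugeAct (invTransf v)) :=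
    continuous_gaugeAct (invTransf v)
  have h := preimage_regSet_eq (μ := piHaar (F.P K) (k + 1) (SU N)) (f := fun V => transportOfRecord F N K k ρ V)
    hΦc hΨc (measurePreserving_gaugeAct v) (measurePreserving_gaugeAct (invTransf v))
    (gaugeAct_inv_gaugeAct v) (gaugeAct_gaugeAct_inv v) (transportOfRecord_comp_gaugeAct_ae_eq_of_ae hk hρ hlift v)
  have h' := congrArg (fun s : Set (PBond (F.P K) (k + 1) → SU N) => V ∈ s) h
  simp only [mem_preimage, eq_iff_iff] at h'
  exact h'

/-- **THE CANONICAL-VERSION TRANSPORT IS GAUGE INVARIANT ON ITS MAXIMAL REGULAR SET, a.e. antecedent**: for `k < K`, `ρ` integrable and a.e.-lift-invariant, every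
coarse `v` and every `V ∈ regSetOfRecord K k ρ`: `TcanOfRecord K k ρ (V^v) = TcanOfRecord K k ρ V` (K0e's `TcanOfRecord_gaugeAct_of_mem_regSet`, proof verbatim).
[cite: Balaban1987RG1, (0.13) p.254 and p.263] -/
theorem TcanOfRecord_gaugeAct_of_mem_regSet_of_ae {K k : ℕ} (hk : k < K) {ρ : Density (F.P K) k (SU N)} (hρ : Integrable ρ (fieldMeasure (F.P K) k (SU N)))
    (hlift : ∀ v : GaugeTransf (F.P K) (k + 1) (SU N), ∀ᵐ U ∂(fieldMeasure (F.P K) k (SU N)), ρ (gaugeAct (liftTransf v) U) = ρ U)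
    (v : GaugeTransf (F.P K) (k + 1) (SU N)) {V : PBond (F.P K) (k + 1) → SU N} (hV : V ∈ regSetOfRecord F N K k ρ) :
    TcanOfRecord F N K k ρ (gaugeAct v V) = TcanOfRecord F N K k ρ V := by
  haveI := isOpenPosMeasure_piHaar_SUN N (F.P K) (k + 1)
  have hΦc : Continuous (X := PBond (F.P K) (k + 1) → SU N) (Y := PBond (F.P K) (k + 1) → SU N) (gaugeAct v) :=
    continuous_gaugeAct v
  have hΨc : Continuous (X := PBond (F.P K) (k + 1) → SU N) (Y := PBond (F.P K) (k + 1) → SU N) (gaugeAct (invTransf v)) :=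
    continuous_gaugeAct (invTransf v)
  exact canonVersion_comp_eqOn (μ := piHaar (F.P K) (k + 1) (SU N)) (f := fun V => transportOfRecord F N K k ρ V)
    hΦc hΨc (measurePreserving_gaugeAct v) (measurePreserving_gaugeAct (invTransf v))
    (gaugeAct_inv_gaugeAct v) (gaugeAct_gaugeAct_inv v) (transportOfRecord_comp_gaugeAct_ae_eq_of_ae hk hρ hlift v) hV

variable (F N) in
/-- **THE ON-SET PER-STEP PROPERTY OF `TβOfRecord₁₃ = TcanOfRecord`, a.e. antecedent** (dag-n24-c's `stepOn_TβOfRecord₁₃_of_subset_regSet` in the shape the a.e. engine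
of §3 reads): for `j < K`, `ρ` integrable at step `j` and `D ⊆ regSetOfRecord K j ρ`, IF `ρ` is lift-invariant `dU`-a.e. THEN its canonical-version transform is gauge
invariant at every point of `D`. [cite: Balaban1987RG1, (0.13) p.254 and p.263] -/
theorem stepOn_TβOfRecord₁₃_of_subset_regSet_of_ae {K j : ℕ} (hj : j < K) (ρ : Density (F.P K) j (SU N))
    (hint : Integrable ρ (fieldMeasure (F.P K) j (SU N))) {D : Set (GaugeField (F.P K) (j + 1) (SU N))} (hD : D ⊆ regSetOfRecord F N K j ρ) :
    (∀ v : GaugeTransf (F.P K) (j + 1) (SU N), ∀ᵐ U ∂(fieldMeasure (F.P K) j (SU N)), ρ (gaugeAct (liftTransf v) U) = ρ U) →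
      ∀ (v : GaugeTransf (F.P K) (j + 1) (SU N)) (V : GaugeField (F.P K) (j + 1) (SU N)), V ∈ D →
        TβOfRecord₁₃ F N K j ρ (gaugeAct v V) = TβOfRecord₁₃ F N K j ρ V :=
  fun hlift v _ hV => TcanOfRecord_gaugeAct_of_mem_regSet_of_ae hj hint hlift v (hD hV)

end Gauge

/-! ## §3. dag-n09-a's MODULE 5 §1–§3 in a.e. currency: `A_k` invariant ON the bookkeeping sets from an a.e.-lift-invariant χ vanishing a.e. off them -/

section Engine

variable {F : T4Family} {N : ℕ} [NeZero N]

/-- **THE (0.19) DENSITY IS A.E.-LIFT-INVARIANT FROM ON-SET INVARIANCE OF `A`**: if `χ(U^{ṽ}) = χ(U)` and `U ∉ D ⇒ χ(U) = 0` hold for `dU`-a.e. `U`, `GF` is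
lift-invariant, and `A(U^{ṽ}) = A(U)` for every `U ∈ D`, then `χ·exp[−GF/g² + A]` satisfies `ρ(U^{ṽ}) = ρ(U)` for `dU`-a.e. `U` (on `D` by the invariance of `A`, off `D`
both sides vanish) — dag-n09-a's `liftInvariant_integrand_of_invOn` with the two χ-hypotheses weakened to a.e. [cite: Balaban1987RG1, (0.19) p.255 and p.263] -/
theorem integrand_comp_liftAct_ae_eq_of_invOn {K j : ℕ} {χ GF A : Density (F.P K) j (SU N)}
    (hχ : ∀ v : GaugeTransf (F.P K) (j + 1) (SU N), ∀ᵐ U ∂(fieldMeasure (F.P K) j (SU N)), χ (gaugeAct (liftTransf v) U) = χ U)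
    (hGF : LiftInvariant GF) {D : Set (GaugeField (F.P K) j (SU N))}
    (hχD : ∀ᵐ U ∂(fieldMeasure (F.P K) j (SU N)), U ∉ D → χ U = 0)
    (hA : ∀ (v : GaugeTransf (F.P K) (j + 1) (SU N)) (U : GaugeField (F.P K) j (SU N)), U ∈ D → A (gaugeAct (liftTransf v) U) = A U) (gk : ℝ)
    (v : GaugeTransf (F.P K) (j + 1) (SU N)) :
    ∀ᵐ U ∂(fieldMeasure (F.P K) j (SU N)), integrand χ GF gk A (gaugeAct (liftTransf v) U) = integrand χ GF gk A U := by
  filter_upwards [hχ v, hχD] with U hχU hDU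
  rw [integrand_apply, integrand_apply, hχU, hGF v U]
  by_cases hU : U ∈ D
  · rw [hA v U hU]
  · rw [hDU hU, zero_mul, zero_mul]

/-- **THE EFFECTIVE ACTIONS ARE GAUGE INVARIANT ON THE BOOKKEEPING SETS, a.e. χ-hypotheses** (p. 263 «the action A_k(U) defined on the space U_k(ε₀) … is gauge
invariant»): for `n ≤ m + K`, sets `D j`, `χ_j` a.e.-lift-invariant and a.e.-vanishing off `D j` (`j < n`), and the per-step property «`ρ_j` a.e.-lift-invariant ⇒
`T K j ρ_j` invariant ON `D (j+1)`» at the densities met, every `A_k`, `k ≤ n`, satisfies `A_k(V^v) = A_k(V)` for all `V ∈ D k` (`A_0` everywhere) — dag-n09-a's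
induction `invOn_effActionHT_of_stepsOn` with `invOn_effActionHT_succ_of_stepOn` BY NAME and §3's a.e. density step. [cite: Balaban1987RG1, p.263, (0.13) p.254 and (0.19) p.255] -/
theorem invOn_effActionHT_of_stepsOn_ae (T : Transport F N) (χ : (K : ℕ) → (ℕ → ℝ) → (k : ℕ) → Density (F.P K) k (SU N)) (K : ℕ) (g : ℕ → ℝ)
    {n : ℕ} (hn : n ≤ (F.P K).m + (F.P K).K) (D : (j : ℕ) → Set (GaugeField (F.P K) j (SU N)))
    (hχ : ∀ j < n, ∀ v : GaugeTransf (F.P K) (j + 1) (SU N), ∀ᵐ U ∂(fieldMeasure (F.P K) j (SU N)), χ K g j (gaugeAct (liftTransf v) U) = χ K g j U)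
    (hχD : ∀ j < n, ∀ᵐ U ∂(fieldMeasure (F.P K) j (SU N)), U ∉ D j → χ K g j U = 0)
    (hstep : ∀ j < n, (∀ v : GaugeTransf (F.P K) (j + 1) (SU N), ∀ᵐ U ∂(fieldMeasure (F.P K) j (SU N)),
        integrand (χ K g j) (gfOfRecord F N K j) (g j) (effActionHT F N T χ K g j) (gaugeAct (liftTransf v) U) =
          integrand (χ K g j) (gfOfRecord F N K j) (g j) (effActionHT F N T χ K g j) U) →
      ∀ (v : GaugeTransf (F.P K) (j + 1) (SU N)) (V : GaugeField (F.P K) (j + 1) (SU N)), V ∈ D (j + 1) →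
        T K j (integrand (χ K g j) (gfOfRecord F N K j) (g j) (effActionHT F N T χ K g j)) (gaugeAct v V) =
          T K j (integrand (χ K g j) (gfOfRecord F N K j) (g j) (effActionHT F N T χ K g j)) V) :
    ∀ k ≤ n, ∀ (v : GaugeTransf (F.P K) k (SU N)) (V : GaugeField (F.P K) k (SU N)), V ∈ D k →
      effActionHT F N T χ K g k (gaugeAct v V) = effActionHT F N T χ K g k V := by
  intro k
  induction k with
  | zero => intro _ v V _; rw [effActionHT_zero]; exact T4WilsonGaugeFlatDirection.gaugeInvariant_wilsonExponent _ _ v V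
  | succ k ih =>
    intro hk
    have hk' : k < n := Nat.lt_of_succ_le hk
    refine invOn_effActionHT_succ_of_stepOn T χ K g k (hstep k hk' ?_)
    exact integrand_comp_liftAct_ae_eq_of_invOn (hχ k hk') (gfOfRecord_liftInvariant F N K ((Nat.succ_le_of_lt hk').trans hn))
      (hχD k hk') (fun v U hU => ih hk'.le (liftTransf v) U hU) (g k)

/-- **`HCompT` FROM THE [B11] INPUTS + NESTING + THE ON-SET PER-STEP PROPERTY, a.e. χ-hypotheses** (levels `k ≤ n ≤ K`): `HRestrict` + intermediate (1.1)-uniqueness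
⇒ `HOrbit` (`Node00.hOrbit_of_hRestrict_of_unique`); on-set invariance of the actions from `invOn_effActionHT_of_stepsOn_ae`; then dag-n09-a's
`hCompT_of_hOrbit_of_invOn` (covariance of the iterated averages at the orbit points + nesting `Ū^j(U_k V) ∈ D j`).
[cite: Balaban1987RG1, (0.21)–(0.23) p.256, (1.1)–(1.2) p.260, p.263 and (2.16) p.269; Balaban1985Variational, Thm 1 (8)–(10) p.279] -/
theorem hCompT_of_stepsOn_ae (T : Transport F N) (χ : (K : ℕ) → (ℕ → ℝ) → (k : ℕ) → Density (F.P K) k (SU N)) {ε : ℝ} (K : ℕ) (g : ℕ → ℝ)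
    {n : ℕ} (hn : n ≤ K) (D : (j : ℕ) → Set (GaugeField (F.P K) j (SU N)))
    (hχ : ∀ j < n, ∀ v : GaugeTransf (F.P K) (j + 1) (SU N), ∀ᵐ U ∂(fieldMeasure (F.P K) j (SU N)), χ K g j (gaugeAct (liftTransf v) U) = χ K g j U)
    (hχD : ∀ j < n, ∀ᵐ U ∂(fieldMeasure (F.P K) j (SU N)), U ∉ D j → χ K g j U = 0)
    (hstep : ∀ j < n, (∀ v : GaugeTransf (F.P K) (j + 1) (SU N), ∀ᵐ U ∂(fieldMeasure (F.P K) j (SU N)),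
        integrand (χ K g j) (gfOfRecord F N K j) (g j) (effActionHT F N T χ K g j) (gaugeAct (liftTransf v) U) =
          integrand (χ K g j) (gfOfRecord F N K j) (g j) (effActionHT F N T χ K g j) U) →
      ∀ (v : GaugeTransf (F.P K) (j + 1) (SU N)) (V : GaugeField (F.P K) (j + 1) (SU N)), V ∈ D (j + 1) →
        T K j (integrand (χ K g j) (gfOfRecord F N K j) (g j) (effActionHT F N T χ K g j)) (gaugeAct v V) =
          T K j (integrand (χ K g j) (gfOfRecord F N K j) (g j) (effActionHT F N T χ K g j)) V)
    {k : ℕ} (hk : k ≤ n) {dom : Set (GaugeField (F.P K) k (SU N))} (hres : HRestrict F N ε K k dom)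
    (huniq : ∀ V ∈ dom, ∀ j < k, UniqueUkOrbit F N K (j + 1) ε (Averaging.iter (avOfRecord F N K) (j + 1) (Uk F N K k ε V)))
    (hnest : ∀ V ∈ dom, ∀ j < k, Averaging.iter (avOfRecord F N K) j (Uk F N K k ε V) ∈ D j) :
    HCompT F N T χ ε K g k dom :=
  have hn' : n ≤ (F.P K).m + (F.P K).K := hn.trans (Nat.le_add_left _ _)
  hCompT_of_hOrbit_of_invOn T χ K g (hk.trans hn') (hOrbit_of_hRestrict_of_unique F N hres huniq) D
    (fun j hj v W hW => invOn_effActionHT_of_stepsOn_ae T χ K g hn' D hχ hχD hstep j (hj.le.trans hk) v W hW) hnest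

/-- **THE MEMBER OVER A TRANSPORT WITH THE ON-SET PER-STEP PROPERTY, FROM [B11] THM 1 + NESTING, a.e. χ-hypotheses**: dag-n09-a's
`thm3Member_of_indATPlug_of_stepsOn` for a binding world whose run flow is `genFlow β P.g₀` and whose `IndAss k` IS `IndAOfRecordT T' χ ε β …` at the record's own
objects, with (M1)∕support read `dU`-a.e. (`B12NodeKnitIndAPlug.thm3Member_of_indATPlug_of_hCompT` + `hCompT_of_stepsOn_ae`).
[cite: Balaban1987RG1, Thm 3 p.264, (1.1)–(1.3) p.260, p.263 and (2.16) p.269; Balaban1985Variational, Thm 1 p.279] -/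
theorem thm3Member_of_indATPlug_of_stepsOn_ae {w : WorldP} {P : B12.RunParams} (T' : Transport F N)
    (χ : (K : ℕ) → (ℕ → ℝ) → (k : ℕ) → Density (F.P K) k (SU N)) (ε : ℝ) (β : HBeta) (dom : (k : ℕ) → Set (GaugeField (F.P P.K) k (SU N)))
    (D : (j : ℕ) → Set (GaugeField (F.P P.K) j (SU N))) (hflow : (w.C P).flow = genFlow β P.g0)
    (hind : ∀ k, k ≤ P.K → ((w.C P).IndAss k ↔
      IndAOfRecordT F N T' χ ε β P k (prefixOf (genSeq β P.g0) k) (dom k) (effActionOfRecordT F N T' χ β P k) (wilsonBGOfRecord F N ε P k)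
        (EkOfRecordT F N T' χ ε β P k)))
    (hχ : ∀ k, k ≤ P.K → ∀ n ≤ k, χ P.K (extd (prefixOf (genSeq β P.g0) k)) n = χ P.K (genSeq β P.g0) n)
    (hχinv : ∀ j < P.K, ∀ v : GaugeTransf (F.P P.K) (j + 1) (SU N), ∀ᵐ U ∂(fieldMeasure (F.P P.K) j (SU N)),
      χ P.K (genSeq β P.g0) j (gaugeAct (liftTransf v) U) = χ P.K (genSeq β P.g0) j U)
    (hχD : ∀ j < P.K, ∀ᵐ U ∂(fieldMeasure (F.P P.K) j (SU N)), U ∉ D j → χ P.K (genSeq β P.g0) j U = 0)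
    (hstep : ∀ j < P.K, (∀ v : GaugeTransf (F.P P.K) (j + 1) (SU N), ∀ᵐ U ∂(fieldMeasure (F.P P.K) j (SU N)),
        integrand (χ P.K (genSeq β P.g0) j) (gfOfRecord F N P.K j) (genSeq β P.g0 j) (effActionHT F N T' χ P.K (genSeq β P.g0) j)
            (gaugeAct (liftTransf v) U) =
          integrand (χ P.K (genSeq β P.g0) j) (gfOfRecord F N P.K j) (genSeq β P.g0 j) (effActionHT F N T' χ P.K (genSeq β P.g0) j) U) →
      ∀ (v : GaugeTransf (F.P P.K) (j + 1) (SU N)) (V : GaugeField (F.P P.K) (j + 1) (SU N)), V ∈ D (j + 1) →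
        T' P.K j (integrand (χ P.K (genSeq β P.g0) j) (gfOfRecord F N P.K j) (genSeq β P.g0 j) (effActionHT F N T' χ P.K (genSeq β P.g0) j))
            (gaugeAct v V) =
          T' P.K j (integrand (χ P.K (genSeq β P.g0) j) (gfOfRecord F N P.K j) (genSeq β P.g0 j) (effActionHT F N T' χ P.K (genSeq β P.g0) j)) V)
    (h11 : ∀ k, k ≤ P.K → ∀ V ∈ dom k, UkExists F N P.K k ε V ∧ UniqueUkOrbit F N P.K k ε V)
    (hres : ∀ k, k ≤ P.K → HRestrict F N ε P.K k (dom k))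
    (huniq : ∀ k, k ≤ P.K → ∀ V ∈ dom k, ∀ j < k,
      UniqueUkOrbit F N P.K (j + 1) ε (Averaging.iter (avOfRecord F N P.K) (j + 1) (Uk F N P.K k ε V)))
    (hnest : ∀ k, k ≤ P.K → ∀ V ∈ dom k, ∀ j < k, Averaging.iter (avOfRecord F N P.K) j (Uk F N P.K k ε V) ∈ D j) :
    (leavesP w P).smallCouplings → (leavesP w P).smallFieldInductive :=
  thm3Member_of_indATPlug_of_hCompT T' χ ε β dom hflow hind hχ h11 fun k hk =>
    hCompT_of_stepsOn_ae T' χ P.K (genSeq β P.g0) le_rfl D hχinv hχD hstep hk (hres k hk) (huniq k hk) (hnest k hk)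

end Engine

/-! ## §4. At the Stage-13 v1.7 `SepCoPH` record: the Theorem-3 member from (M1-ae), (F7a-ae), (I19), [B11] Thm 1 ×3 and the nesting (F7b) -/

section Stage13

variable {F : T4Family} {N : ℕ} [NeZero N]

/-- **THE THEOREM-3 MEMBER OF N09 AT `(w, P)` FOR A WORLD BOUND TO THE STAGE-13 v1.7 CONSTRUCTION, bookkeeping sets `D j` abstract, a.e. χ-hypotheses** — dag-n24-c's
`thm3Member_stage13SepCoPH_of_stepsOn` with (M1) `hχinv` and the support clause `hχD` read `dU`-ALMOST EVERYWHERE; the inclusion `D (j+1) ⊆ regSetOfRecord K j ρ_j`,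
(I19), [B11] Thm 1's three binders and the nesting `Ū^j(U_k V) ∈ D j` unchanged (pointwise, as print needs them).  §3's engine at `T' := TβOfRecord₁₃`,
`χ := chiβOfRecord₁₃ θ`, fed by def-T's faces (`rfl` ∕ `Iff.rfl`), the cut-off's flow-blindness (`rfl`) and §2's per-step property.  CONDITIONAL; nothing of Bałaban asserted;
N09 NOT discharged. [cite: Balaban1987RG1, Thm 3 p.264, (1.1)–(1.3) p.260, (0.13) p.254, p.256, p.259, p.263, (2.1) p.265, (2.9)–(2.10) pp.266–267, (2.16) p.269; Balaban1985Variational, Thm 1 (8)–(10) p.279] -/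
theorem thm3Member_stage13SepCoPH_of_stepsOn_ae (θ : Stage13HParams F N) (h : θ.Provisos₁₃SepCoPH F N) {w : WorldP}
    (hC : w.C = (datumOfRecord₁₃SepCoPH F N θ h).C) (P : B12.RunParams) (D : (j : ℕ) → Set (GaugeField (F.P P.K) j (SU N)))
    (hχinv : ∀ j < P.K, ∀ v : GaugeTransf (F.P P.K) (j + 1) (SU N), ∀ᵐ U ∂(fieldMeasure (F.P P.K) j (SU N)),
      chiβOfRecord₁₃ F N θ.toStage13Params P.K (gOfRecord₁₃ F N θ.toStage13Params P) j (gaugeAct (liftTransf v) U) =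
        chiβOfRecord₁₃ F N θ.toStage13Params P.K (gOfRecord₁₃ F N θ.toStage13Params P) j U)
    (hχD : ∀ j < P.K, ∀ᵐ U ∂(fieldMeasure (F.P P.K) j (SU N)), U ∉ D j →
      chiβOfRecord₁₃ F N θ.toStage13Params P.K (gOfRecord₁₃ F N θ.toStage13Params P) j U = 0)
    (hint : ∀ j < P.K, Integrable (betaInputOfRecord F N (TβOfRecord₁₃ F N) (chiβOfRecord₁₃ F N θ.toStage13Params) P.K (gOfRecord₁₃ F N θ.toStage13Params P) j)
      (fieldMeasure (F.P P.K) j (SU N)))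
    (hreg : ∀ j < P.K, D (j + 1) ⊆ regSetOfRecord F N P.K j
      (betaInputOfRecord F N (TβOfRecord₁₃ F N) (chiβOfRecord₁₃ F N θ.toStage13Params) P.K (gOfRecord₁₃ F N θ.toStage13Params P) j))
    (h11 : ∀ k, k ≤ P.K → ∀ V ∈ domAltOfRecord F N θ.ν P.K k, UkExists F N P.K k θ.εbg V ∧ UniqueUkOrbit F N P.K k θ.εbg V)
    (hres : ∀ k, k ≤ P.K → HRestrict F N θ.εbg P.K k (domAltOfRecord F N θ.ν P.K k))
    (huniq : ∀ k, k ≤ P.K → ∀ V ∈ domAltOfRecord F N θ.ν P.K k, ∀ j < k,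
      UniqueUkOrbit F N P.K (j + 1) θ.εbg (Averaging.iter (avOfRecord F N P.K) (j + 1) (Uk F N P.K k θ.εbg V)))
    (hnest : ∀ k, k ≤ P.K → ∀ V ∈ domAltOfRecord F N θ.ν P.K k, ∀ j < k, Averaging.iter (avOfRecord F N P.K) j (Uk F N P.K k θ.εbg V) ∈ D j) :
    (leavesP w P).smallCouplings → (leavesP w P).smallFieldInductive :=
  thm3Member_of_indATPlug_of_stepsOn_ae (TβOfRecord₁₃ F N) (chiβOfRecord₁₃ F N θ.toStage13Params) θ.εbg (betaOfRecord₁₃ F N θ.toStage13Params)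
    (fun k => domAltOfRecord F N θ.ν P.K k) D
    (by rw [hC]; exact flow_stage13SepCoPH F N θ h P) (fun k _ => by rw [hC]; exact indAss_stage13SepCoPH_iff F N θ h P k)
    (fun _ _ _ _ => rfl) hχinv hχD (fun j hj => stepOn_TβOfRecord₁₃_of_subset_regSet_of_ae F N hj _ (hint j hj) (hreg j hj)) h11 hres huniq hnest

/-- **THE THEOREM-3 MEMBER AT THE STAGE-13 v1.7 CONSTRUCTION, LOCATED FORM, a.e. CURRENCY** — dag-n24-c's `thm3Member_stage13SepCoPH_of_regSets` with (M1) and (F7a) WEAKENED: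
bookkeeping sets `D 0 := univ`, `D (i+1) := regSetOfRecord K i ρ_i`; displayed: (M1-ae) `χ^{(2.9)}_j(U^{v∘blockOf}) = χ^{(2.9)}_j(U)` for `dU`-a.e. `U`; (F7a-ae) for `dU`-a.e.
`U`, `U ∉ regSetOfRecord K i ρ_i ⇒ χ^{(2.9)}_{i+1}(U) = 0` ([I] p. 256 l. 6 «the characteristic function χ_k restricts the integral to small fluctuation fields», (2.1)
p. 265 L14–17); (I19) integrability; [B11] Thm 1's `h11 ∕ hres ∕ huniq`; (F7b) the nesting of the averaged backgrounds in the maximal regular sets (pointwise, regular points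
only).  CONDITIONAL; nothing of Bałaban asserted; N09 NOT discharged.
[cite: Balaban1987RG1, Thm 3 p.264, (1.1)–(1.3) p.260, (0.13) p.254, p.256, p.259, p.263, (2.1) p.265, (2.9)–(2.10) pp.266–267; Balaban1985Variational, Thm 1 (8)–(10) p.279] -/
theorem thm3Member_stage13SepCoPH_of_regSets_ae (θ : Stage13HParams F N) (h : θ.Provisos₁₃SepCoPH F N) {w : WorldP}
    (hC : w.C = (datumOfRecord₁₃SepCoPH F N θ h).C) (P : B12.RunParams)
    (hχinv : ∀ j < P.K, ∀ v : GaugeTransf (F.P P.K) (j + 1) (SU N), ∀ᵐ U ∂(fieldMeasure (F.P P.K) j (SU N)),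
      chiβOfRecord₁₃ F N θ.toStage13Params P.K (gOfRecord₁₃ F N θ.toStage13Params P) j (gaugeAct (liftTransf v) U) =
        chiβOfRecord₁₃ F N θ.toStage13Params P.K (gOfRecord₁₃ F N θ.toStage13Params P) j U)
    (hχreg : ∀ i, i + 1 < P.K → ∀ᵐ U ∂(fieldMeasure (F.P P.K) (i + 1) (SU N)), U ∉ regSetOfRecord F N P.K i
        (betaInputOfRecord F N (TβOfRecord₁₃ F N) (chiβOfRecord₁₃ F N θ.toStage13Params) P.K (gOfRecord₁₃ F N θ.toStage13Params P) i) →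
      chiβOfRecord₁₃ F N θ.toStage13Params P.K (gOfRecord₁₃ F N θ.toStage13Params P) (i + 1) U = 0)
    (hint : ∀ j < P.K, Integrable (betaInputOfRecord F N (TβOfRecord₁₃ F N) (chiβOfRecord₁₃ F N θ.toStage13Params) P.K (gOfRecord₁₃ F N θ.toStage13Params P) j)
      (fieldMeasure (F.P P.K) j (SU N)))
    (h11 : ∀ k, k ≤ P.K → ∀ V ∈ domAltOfRecord F N θ.ν P.K k, UkExists F N P.K k θ.εbg V ∧ UniqueUkOrbit F N P.K k θ.εbg V)
    (hres : ∀ k, k ≤ P.K → HRestrict F N θ.εbg P.K k (domAltOfRecord F N θ.ν P.K k))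
    (huniq : ∀ k, k ≤ P.K → ∀ V ∈ domAltOfRecord F N θ.ν P.K k, ∀ j < k,
      UniqueUkOrbit F N P.K (j + 1) θ.εbg (Averaging.iter (avOfRecord F N P.K) (j + 1) (Uk F N P.K k θ.εbg V)))
    (hnestreg : ∀ k, k ≤ P.K → ∀ V ∈ domAltOfRecord F N θ.ν P.K k, ∀ i, i + 1 < k →
      Averaging.iter (avOfRecord F N P.K) (i + 1) (Uk F N P.K k θ.εbg V) ∈ regSetOfRecord F N P.K i
        (betaInputOfRecord F N (TβOfRecord₁₃ F N) (chiβOfRecord₁₃ F N θ.toStage13Params) P.K (gOfRecord₁₃ F N θ.toStage13Params P) i)) :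
    (leavesP w P).smallCouplings → (leavesP w P).smallFieldInductive := by
  refine thm3Member_stage13SepCoPH_of_stepsOn_ae θ h hC P
    (fun j => Nat.rec (motive := fun j => Set (GaugeField (F.P P.K) j (SU N))) Set.univ
      (fun i _ => regSetOfRecord F N P.K i
        (betaInputOfRecord F N (TβOfRecord₁₃ F N) (chiβOfRecord₁₃ F N θ.toStage13Params) P.K (gOfRecord₁₃ F N θ.toStage13Params P) i)) j)
    hχinv ?_ hint (fun j _ => subset_rfl) h11 hres huniq ?_
  · intro j hj
    cases j with
    | zero => exact Filter.Eventually.of_forall fun U hU => absurd (Set.mem_univ U) hU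
    | succ i => exact hχreg i hj
  · intro k hk V hV j hjk
    cases j with
    | zero => exact Set.mem_univ _
    | succ i => exact hnestreg k hk V hV i hjk

/-- **THE `∀ P` FORM = N24's DISPLAYED BINDER `h09T` AT A WORLD BOUND TO THE STAGE-13 v1.7 CONSTRUCTION, a.e. CURRENCY** (17H's `h09inv ∕ h09supp` may be fed in their
a.e. weakenings; every pointwise supplier still applies through `Filter.Eventually.of_forall`).  CONDITIONAL; N09 NOT discharged; K1⁷ NOT closed.
[cite: Balaban1987RG1, Thm 3 p.264, (1.1)–(1.3) p.260, (2.9)–(2.10) pp.266–267; Balaban1985Variational, Thm 1 (8)–(10) p.279] -/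
theorem thm3Member_forall_stage13SepCoPH_of_regSets_ae (θ : Stage13HParams F N) (h : θ.Provisos₁₃SepCoPH F N) {w : WorldP}
    (hC : w.C = (datumOfRecord₁₃SepCoPH F N θ h).C)
    (hχinv : ∀ (P : B12.RunParams), ∀ j < P.K, ∀ v : GaugeTransf (F.P P.K) (j + 1) (SU N), ∀ᵐ U ∂(fieldMeasure (F.P P.K) j (SU N)),
      chiβOfRecord₁₃ F N θ.toStage13Params P.K (gOfRecord₁₃ F N θ.toStage13Params P) j (gaugeAct (liftTransf v) U) =
        chiβOfRecord₁₃ F N θ.toStage13Params P.K (gOfRecord₁₃ F N θ.toStage13Params P) j U)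
    (hχreg : ∀ (P : B12.RunParams) (i : ℕ), i + 1 < P.K → ∀ᵐ U ∂(fieldMeasure (F.P P.K) (i + 1) (SU N)), U ∉ regSetOfRecord F N P.K i
        (betaInputOfRecord F N (TβOfRecord₁₃ F N) (chiβOfRecord₁₃ F N θ.toStage13Params) P.K (gOfRecord₁₃ F N θ.toStage13Params P) i) →
      chiβOfRecord₁₃ F N θ.toStage13Params P.K (gOfRecord₁₃ F N θ.toStage13Params P) (i + 1) U = 0)
    (hint : ∀ (P : B12.RunParams), ∀ j < P.K, Integrable (betaInputOfRecord F N (TβOfRecord₁₃ F N) (chiβOfRecord₁₃ F N θ.toStage13Params) P.K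
      (gOfRecord₁₃ F N θ.toStage13Params P) j) (fieldMeasure (F.P P.K) j (SU N)))
    (h11 : ∀ (P : B12.RunParams) (k : ℕ), k ≤ P.K → ∀ V ∈ domAltOfRecord F N θ.ν P.K k, UkExists F N P.K k θ.εbg V ∧ UniqueUkOrbit F N P.K k θ.εbg V)
    (hres : ∀ (P : B12.RunParams) (k : ℕ), k ≤ P.K → HRestrict F N θ.εbg P.K k (domAltOfRecord F N θ.ν P.K k))
    (huniq : ∀ (P : B12.RunParams) (k : ℕ), k ≤ P.K → ∀ V ∈ domAltOfRecord F N θ.ν P.K k, ∀ j < k,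
      UniqueUkOrbit F N P.K (j + 1) θ.εbg (Averaging.iter (avOfRecord F N P.K) (j + 1) (Uk F N P.K k θ.εbg V)))
    (hnestreg : ∀ (P : B12.RunParams) (k : ℕ), k ≤ P.K → ∀ V ∈ domAltOfRecord F N θ.ν P.K k, ∀ i, i + 1 < k →
      Averaging.iter (avOfRecord F N P.K) (i + 1) (Uk F N P.K k θ.εbg V) ∈ regSetOfRecord F N P.K i
        (betaInputOfRecord F N (TβOfRecord₁₃ F N) (chiβOfRecord₁₃ F N θ.toStage13Params) P.K (gOfRecord₁₃ F N θ.toStage13Params P) i)) :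
    ∀ P : B12.RunParams, (leavesP w P).smallCouplings → (leavesP w P).smallFieldInductive :=
  fun P => thm3Member_stage13SepCoPH_of_regSets_ae θ h hC P (hχinv P) (hχreg P) (hint P) (h11 P) (hres P) (huniq P) (hnestreg P)

/-- **THE `∀ P` FORM, (I19) REPLACED BY (H-U), a.e. CURRENCY** — dag-n24-c v1.1's `…_of_regSets_of_measurableUk` shape: the integrability binder supplied by
`integrable_betaInput_stage13_of_measurableUk` from the MEASURABILITY of the minimiser selection `W ↦ U_{k+1}(W)` (`hU`).  (The pointwise located form is the special
case of the a.e. one through `Filter.Eventually.of_forall`.)  CONDITIONAL; N09 NOT discharged; K1⁷ NOT closed.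
[cite: Balaban1987RG1, Thm 3 p.264, (0.19) p.255, (1.1)–(1.3) p.260, (2.9)–(2.10) pp.266–267; Balaban1985Variational, Thm 1 (8)–(10) p.279] -/
theorem thm3Member_forall_stage13SepCoPH_of_regSets_of_measurableUk_ae (θ : Stage13HParams F N) (h : θ.Provisos₁₃SepCoPH F N) {w : WorldP}
    (hC : w.C = (datumOfRecord₁₃SepCoPH F N θ h).C)
    (hχinv : ∀ (P : B12.RunParams), ∀ j < P.K, ∀ v : GaugeTransf (F.P P.K) (j + 1) (SU N), ∀ᵐ U ∂(fieldMeasure (F.P P.K) j (SU N)),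
      chiβOfRecord₁₃ F N θ.toStage13Params P.K (gOfRecord₁₃ F N θ.toStage13Params P) j (gaugeAct (liftTransf v) U) =
        chiβOfRecord₁₃ F N θ.toStage13Params P.K (gOfRecord₁₃ F N θ.toStage13Params P) j U)
    (hU : ∀ (P : B12.RunParams) (k : ℕ), k < P.K → Measurable (Uk F N P.K (k + 1) θ.ν.εreg))
    (hχreg : ∀ (P : B12.RunParams) (i : ℕ), i + 1 < P.K → ∀ᵐ U ∂(fieldMeasure (F.P P.K) (i + 1) (SU N)), U ∉ regSetOfRecord F N P.K i
        (betaInputOfRecord F N (TβOfRecord₁₃ F N) (chiβOfRecord₁₃ F N θ.toStage13Params) P.K (gOfRecord₁₃ F N θ.toStage13Params P) i) →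
      chiβOfRecord₁₃ F N θ.toStage13Params P.K (gOfRecord₁₃ F N θ.toStage13Params P) (i + 1) U = 0)
    (h11 : ∀ (P : B12.RunParams) (k : ℕ), k ≤ P.K → ∀ V ∈ domAltOfRecord F N θ.ν P.K k, UkExists F N P.K k θ.εbg V ∧ UniqueUkOrbit F N P.K k θ.εbg V)
    (hres : ∀ (P : B12.RunParams) (k : ℕ), k ≤ P.K → HRestrict F N θ.εbg P.K k (domAltOfRecord F N θ.ν P.K k))
    (huniq : ∀ (P : B12.RunParams) (k : ℕ), k ≤ P.K → ∀ V ∈ domAltOfRecord F N θ.ν P.K k, ∀ j < k,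
      UniqueUkOrbit F N P.K (j + 1) θ.εbg (Averaging.iter (avOfRecord F N P.K) (j + 1) (Uk F N P.K k θ.εbg V)))
    (hnestreg : ∀ (P : B12.RunParams) (k : ℕ), k ≤ P.K → ∀ V ∈ domAltOfRecord F N θ.ν P.K k, ∀ i, i + 1 < k →
      Averaging.iter (avOfRecord F N P.K) (i + 1) (Uk F N P.K k θ.εbg V) ∈ regSetOfRecord F N P.K i
        (betaInputOfRecord F N (TβOfRecord₁₃ F N) (chiβOfRecord₁₃ F N θ.toStage13Params) P.K (gOfRecord₁₃ F N θ.toStage13Params P) i)) :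
    ∀ P : B12.RunParams, (leavesP w P).smallCouplings → (leavesP w P).smallFieldInductive :=
  fun P => thm3Member_stage13SepCoPH_of_regSets_ae θ h hC P (hχinv P) (hχreg P)
    (integrable_betaInput_stage13_of_measurableUk θ.toStage13Params P (hU P)) (h11 P) (hres P) (huniq P) (hnestreg P)

end Stage13

end Summit.QuantumFields.YangMills.BalabanUVNodes.N09AtRecord13SepCoPHSupportAE

end
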